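import Summits.Ventures.Crystal3D.Theorems.StickyWulffConstantStackingLiminfTwelveVectors
import Summits.Ventures.Crystal3D.StickySpheres.ContactGraph
import HarnessLib

/-!
# Twelve bond slots per ball: coordination + vacant neighbour positions = 12 (helper toward
# `StackingLiminf`, stmt-Ventures-19145; front end S1 of stub (B) `MollifiedUpper` of LayerChain v4)

Cell `crystal3d-full`, venture `Summits/Ventures/Crystal3D`.  For an injective configuration `x` inside
the Barlow stacking of a Hägg word `σ`, ball `i` (in layer `k`, i.e. height `k·√(2/3)`) has the twelve
neighbour POSITIONS `x i ± aVec m`, `x i + b_{σ k, m}`, `x i − b_{σ (k−1), m}` (`…TwelveVectors.lean`):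
exactly `coordination x i` of them are occupied and the rest are VACANT, so

`∑_i #(vacant positions of ball i) + 2 · numContacts x = 12 · N`  (`sum_vacant_add_two_mul_numContacts`).

This is the physical-position form of the bond-slot identity of `…StackingLiminfBondSlots.lean` (p504513)
and the counting half of BLUEPRINT-v4B (S1): summed over the bond classes, the unmatched centres in the sharp
triangle inequality `rung_sum_translate_sub_l1` (p504959) number exactly `2D = 12N − 2·numContacts`.
WHAT THIS IS NOT: the `L¹` estimate itself; pure bookkeeping.
-/

noncomputable section

namespace Summit.Ventures.Crystal3D.Theorems

open Set
open Literature.MathematicalPhysics.StatisticalMechanics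
open Summit.Ventures.Crystal3D.LayerChain (aVec bPlus bMinus)

open scoped Classical in
/-- **Twelve slots per ball.**  For ball `i` of an injective configuration in `barlowStacking 1 √(2/3) σ`
lying at height `k·√(2/3)`: its coordination number plus the number of VACANT positions among its twelve
neighbour vectors equals `12`. -/
theorem coordination_add_vacant_eq_twelve {σ : ℤ → ℤ} (hσ : IsHaggSeq σ) {N : ℕ}
    (x : Fin N → EuclideanSpace ℝ (Fin 3)) (hx : Function.Injective x)
    (hmem : ∀ i, x i ∈ barlowStacking 1 (Real.sqrt (2 / 3)) σ) (i : Fin N) (k : ℤ)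
    (hk : x i 2 = k * Real.sqrt (2 / 3)) :
    Summit.Ventures.Crystal3D.coordination x i +
      ((((Finset.univ.image fun m : Fin 3 => x i + WithLp.toLp 2 (aVec m)) ∪
          (Finset.univ.image fun m : Fin 3 => x i - WithLp.toLp 2 (aVec m)) ∪
          (Finset.univ.image fun m : Fin 3 =>
            x i + WithLp.toLp 2 (if σ k = 1 then bPlus m else bMinus m)) ∪
          (Finset.univ.image fun m : Fin 3 =>
            x i - WithLp.toLp 2 (if σ (k - 1) = 1 then bPlus m else bMinus m)))).filter
        fun w => w ∉ Set.range x).card = 12 := by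
  -- coordinates of ball `i`
  obtain ⟨k', a, b, hxi⟩ := hmem i
  have hH : Real.sqrt (2 / 3) ≠ 0 := (Real.sqrt_pos.2 (by norm_num)).ne'
  have hk' : k' = k := by
    have h2 := hk
    rw [hxi, barlowPos_apply_two] at h2
    exact_mod_cast mul_right_cancel₀ hH h2
  subst hk'
  set S : Finset (EuclideanSpace ℝ (Fin 3)) :=
    ((Finset.univ.image fun m : Fin 3 => x i + WithLp.toLp 2 (aVec m)) ∪
          (Finset.univ.image fun m : Fin 3 => x i - WithLp.toLp 2 (aVec m)) ∪
          (Finset.univ.image fun m : Fin 3 =>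
            x i + WithLp.toLp 2 (if σ k' = 1 then bPlus m else bMinus m)) ∪
          (Finset.univ.image fun m : Fin 3 =>
            x i - WithLp.toLp 2 (if σ (k' - 1) = 1 then bPlus m else bMinus m))) with hSdef
  -- the shell of `x i` is exactly `S`
  have hS : ∀ w, w ∈ S ↔
      (w ∈ barlowStacking 1 (Real.sqrt (2 / 3)) σ ∧ dist (x i) w = 1) := by
    intro w
    rw [hxi, mem_touching_iff_twelve_vectors hσ k' a b w, ← hxi]
    simp only [hSdef, Finset.mem_union, Finset.mem_image, Finset.mem_univ, true_and, eq_comm,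
      or_assoc]
  have hSset : {w | w ∈ barlowStacking 1 (Real.sqrt (2 / 3)) σ ∧
      dist (barlowPos 1 (Real.sqrt (2 / 3)) σ k' a b) w = 1} = ↑S := by
    ext w; rw [Finset.mem_coe, hS w, hxi]; rfl
  have hcard : S.card = 12 := by
    have := ncard_touching_barlowPos hσ one_pos sqrt_two_thirds_sq k' a b
    rwa [hSset, Set.ncard_coe_finset] at this
  -- occupied positions ↔ contact neighbours
  have hocc : Summit.Ventures.Crystal3D.coordination x i = (S.filter fun w => w ∈ Set.range x).card := by
    unfold Summit.Ventures.Crystal3D.coordination Summit.Ventures.Crystal3D.contactNeighbors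
    refine Finset.card_bij (fun j _ => x j) (fun j hj => ?_) (fun j₁ _ j₂ _ h => hx h) (fun w hw => ?_)
    · rw [Finset.mem_filter] at hj
      rw [Finset.mem_filter, hS]
      exact ⟨⟨hmem j, hj.2.2⟩, Set.mem_range_self j⟩
    · rw [Finset.mem_filter, hS] at hw
      obtain ⟨⟨_, hd⟩, j, rfl⟩ := hw
      refine ⟨j, ?_, rfl⟩
      rw [Finset.mem_filter]
      refine ⟨Finset.mem_univ _, ?_, hd⟩
      rintro rfl
      rw [dist_self] at hd
      exact zero_ne_one hd
  rw [hocc, Finset.card_filter_add_card_filter_not, hcard]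

open scoped Classical in
/-- **Bond slots, physical form**: summed over the balls, the vacant neighbour positions plus twice the
number of contacts make `12 N` (every ball has twelve slots).  `kf i` is the layer index of ball `i`
(its height is `kf i · √(2/3)`). -/
theorem sum_vacant_add_two_mul_numContacts {σ : ℤ → ℤ} (hσ : IsHaggSeq σ) {N : ℕ}
    (x : Fin N → EuclideanSpace ℝ (Fin 3)) (hx : Function.Injective x)
    (hmem : ∀ i, x i ∈ barlowStacking 1 (Real.sqrt (2 / 3)) σ) (kf : Fin N → ℤ)
    (hkf : ∀ i, x i 2 = kf i * Real.sqrt (2 / 3)) :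
    (∑ i, ((((Finset.univ.image fun m : Fin 3 => x i + WithLp.toLp 2 (aVec m)) ∪
          (Finset.univ.image fun m : Fin 3 => x i - WithLp.toLp 2 (aVec m)) ∪
          (Finset.univ.image fun m : Fin 3 =>
            x i + WithLp.toLp 2 (if σ (kf i) = 1 then bPlus m else bMinus m)) ∪
          (Finset.univ.image fun m : Fin 3 =>
            x i - WithLp.toLp 2 (if σ ((kf i) - 1) = 1 then bPlus m else bMinus m)))).filter
        fun w => w ∉ Set.range x).card) +
      2 * Summit.Ventures.Crystal3D.numContacts x = 12 * N := by
  rw [← Summit.Ventures.Crystal3D.sum_coordination_eq, ← Finset.sum_add_distrib]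
  have h12 : ∀ i ∈ (Finset.univ : Finset (Fin N)),
      ((((Finset.univ.image fun m : Fin 3 => x i + WithLp.toLp 2 (aVec m)) ∪
          (Finset.univ.image fun m : Fin 3 => x i - WithLp.toLp 2 (aVec m)) ∪
          (Finset.univ.image fun m : Fin 3 =>
            x i + WithLp.toLp 2 (if σ (kf i) = 1 then bPlus m else bMinus m)) ∪
          (Finset.univ.image fun m : Fin 3 =>
            x i - WithLp.toLp 2 (if σ ((kf i) - 1) = 1 then bPlus m else bMinus m)))).filter
        fun w => w ∉ Set.range x).card + Summit.Ventures.Crystal3D.coordination x i = 12 := by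
    intro i _
    rw [add_comm]
    exact coordination_add_vacant_eq_twelve hσ x hx hmem i (kf i) (hkf i)
  rw [Finset.sum_congr rfl h12, Finset.sum_const, Finset.card_univ, Fintype.card_fin, smul_eq_mul,
    mul_comm]

end Summit.Ventures.Crystal3D.Theorems

end
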